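import Summits.QuantumAdvantage.QuantumAdvantage.Theorems.CubicForrelationNearExactIsExactKtGapTwoStep

/-!
# Crux `CubicForrelation.NearExactIsExact` (stmt-QuantumAdvantage-14043) — Kasami–Tokura for CUBICS below `2d`, II: descent along a period,
  and the weight of a cubic supported inside an affine hyperplane

Certificate seat `b2b-cforr-cert` (gen 19).  HONEST FRAMING: elementary coding-theory TOOLS (standard axioms, uniform in the number of bits `m`)
for the brick `…KtThreeStructure.lean` (the `r = 3` case of Kasami–Tokura's theorem: a cubic with `0 < #E < 2^{m−2}` ones is supported in
an affine hyperplane or has `#E = 7·2^{m−5}`; hence the weights of `RM(3,m)` below `2^{m−2}` are `2^{m−2} − 2^i`, `(m−3)/2 ≤ i`).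
NOT summit progress.

* `kt3_descend_period`: a function of degree `≤ d` on `k+1` bits with a non-zero period comes from `k` bits with half the ones
  (restriction to a coordinate hyperplane, `ktg_restrict`).
* `kt3_hyperplane_weight`: a cubic `c` on `m` bits with `4·#E < 2^m` supported inside `{⟨x,z⟩ = b}`, `z ≠ 0`, has `4·#E + 2^s = 2^m` with
  `m + 1 ≤ 2s`: for `v` with `⟨v,z⟩ = 1` the derivative `c ⊕ c(·⊕v)` is a `v`-periodic QUADRATIC with `2·#E` ones, its Walsh value at `0`
  is `2^m − 4#E = 2^s` (plateau, `stub_quadWalshPlateau`), and its spectrum vanishes on the half `{⟨v,y⟩ = 1}`, so Parseval gives `2s ≥ m+1`.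
  On 12 bits: `#E ∈ {0, 512, 768, 896, 960, 992}`.

References: T. Kasami, N. Tokura, *On the weight structure of Reed–Muller codes*, IEEE Trans. IT 16 (1970) 752–759, Thm 1; F. J. MacWilliams,
N. J. A. Sloane (1977) Ch. 15 §2 (Dickson's theorem), §3.  Everything below is proved from Mathlib and the tree; axioms are the standard three.
-/

set_option linter.dupNamespace false -- D-0017: single-problem summit ⇒ `QuantumAdvantage.QuantumAdvantage` by design

noncomputable section

namespace Summit.QuantumAdvantage.QuantumAdvantage.Theorems.CubicForrelation.NearExactIsExact

open Finset
open Literature.Computability.QuantumComplexity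
open Literature.Computability.QuantumComplexity.BuzetChailloux (bxor zeroVec bxor_bxor_cancel_left bxor_zeroVec zeroVec_bxor bxor_comm
  bxor_self twist_zeroVec_right twist_bxor_right sum_twist_left)
open Literature.Computability.QuantumComplexity.DerivativeWalsh (W twist_bxor_left)
open Literature.Computability.QuantumComplexity.Simon (twist_eq_one_or)
open Summit.QuantumAdvantage.QuantumAdvantage.Theorems.SignedCubicForrelationNotPrBPP (knf_isDegLeFun_ip)

/-! ### Descent along a period -/

/-- **Descent along a period.**  If a Boolean function `c` of degree `≤ d` on `k + 1` bits has a non-zero period `a` (`c(x ⊕ a) = c(x)` for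
all `x`), then some Boolean function of degree `≤ d` on `k` bits has exactly half as many ones (restrict to the coordinate hyperplane
`{x_{i₀} = 0}`, `a_{i₀} = 1`; the translation by `a` swaps the two halves). [folklore] -/
theorem kt3_descend_period {k d : ℕ} (c : (Fin (k + 1) → Bool) → Bool) (hc : IsDegLeFun d c) (a : Fin (k + 1) → Bool)
    (ha : a ≠ zeroVec) (hper : ∀ x, c (bxor x a) = c x) :
    ∃ c' : (Fin k → Bool) → Bool, IsDegLeFun d c' ∧ 2 * #(univ.filter fun y => c' y = true) = #(univ.filter fun x => c x = true) := by
  classical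
  obtain ⟨i₀, hi₀⟩ : ∃ i, a i = true := by
    by_contra h
    push Not at h
    exact ha (funext fun i => by simpa [zeroVec] using h i)
  set z : Fin (k + 1) → Bool := fun i => decide (i = i₀) with hz
  have hzi : z i₀ = true := by simp [hz]
  have hcoord : ∀ x : Fin (k + 1) → Bool, decide (Odd #(univ.filter fun i => (x i && z i) = true)) = x i₀ := by
    intro x
    rw [ktg_card_and_split _ _ i₀, hzi, Bool.and_true]
    have h0 : #(univ.filter fun j : Fin k => (x (i₀.succAbove j) && z (i₀.succAbove j)) = true) = 0 := by
      refine card_eq_zero.2 (filter_eq_empty_iff.2 fun j _ => ?_)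
      simp [hz, Fin.succAbove_ne]
    rw [h0, add_zero]
    cases x i₀ <;> simp
  obtain ⟨c', hc', hcard'⟩ := ktg_restrict c hc z i₀ hzi false
  have hsym : #(univ.filter fun x => c x = true ∧ decide (Odd #(univ.filter fun i => (x i && z i) = true)) = true) =
      #(univ.filter fun x => c x = true ∧ decide (Odd #(univ.filter fun i => (x i && z i) = true)) = false) := by
    simp_rw [hcoord]
    refine card_nbij' (fun x => bxor x a) (fun x => bxor x a) (fun x hx => ?_) (fun x hx => ?_)
      (fun x _ => by simp [iw_bxor_assoc]) (fun x _ => by simp [iw_bxor_assoc])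
    · rw [mem_coe, mem_filter] at hx ⊢
      refine ⟨mem_univ _, by rw [hper]; exact hx.2.1, ?_⟩
      show (x i₀ ^^ a i₀) = false
      rw [hx.2.2, hi₀]; rfl
    · rw [mem_coe, mem_filter] at hx ⊢
      refine ⟨mem_univ _, by rw [hper]; exact hx.2.1, ?_⟩
      show (x i₀ ^^ a i₀) = true
      rw [hx.2.2, hi₀]; rfl
  have hadd := ktg_half_add c z
  rw [hsym, ← hcard'] at hadd
  exact ⟨c', hc', by omega⟩

/-! ### The weight of a cubic supported inside an affine hyperplane -/

/-- **Cubics inside a hyperplane.**  If `c` has degree `≤ 3` on `m` bits, `4·#E < 2^m`, and its support lies inside the affine hyperplane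
`{⟨x,z⟩ = b}` (`z ≠ 0`), then `4·#E + 2^s = 2^m` for some `s` with `m + 1 ≤ 2s` — i.e. `#E ∈ {2^{m−2} − 2^{i} : (m−3)/2 ≤ i}` (on 12 bits:
`0, 512, 768, 896, 960, 992`).  Proof: for `v` with `⟨v,z⟩ = 1` the derivative `Q = c ⊕ c(·⊕v)` is a `v`-periodic quadratic with `2·#E` ones;
its Walsh value at `0` is `2^m − 4#E = 2^s` (plateau), and its spectrum vanishes on the half `{⟨v,y⟩ = 1}`, so Parseval forces `2s ≥ m + 1`.
[this work; cite: KasamiTokura1970, Thm 1] -/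
theorem kt3_hyperplane_weight {m : ℕ} (c : (Fin m → Bool) → Bool) (hc : IsDegLeFun 3 c)
    (h4 : 4 * #(univ.filter fun x => c x = true) < 2 ^ m) (z : Fin m → Bool) (hz : z ≠ zeroVec) (b : Bool)
    (hE : ∀ x, c x = true → decide (Odd #(univ.filter fun i => (x i && z i) = true)) = b) :
    ∃ s : ℕ, 4 * #(univ.filter fun x => c x = true) + 2 ^ s = 2 ^ m ∧ m + 1 ≤ 2 * s := by
  classical
  set S := univ.filter (fun x : Fin m → Bool => c x = true) with hSdef
  set ℓ : (Fin m → Bool) → Bool := fun x => decide (Odd #(univ.filter fun i => (x i && z i) = true)) with hℓdef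
  have htw : ∀ x, twist x z = signOf (ℓ x) := fun x => vg_twist_eq_signOf x z
  -- a transversal direction
  obtain ⟨v, hv⟩ := es_exists_twist_neg hz
  rw [twist_comm] at hv
  have hℓv : ∀ x, ℓ (bxor x v) = !ℓ x := by
    intro x
    have h := twist_bxor_left x v z
    rw [htw, htw, hv] at h
    revert h; cases ℓ (bxor x v) <;> cases ℓ x <;> norm_num [signOf]
  have hcv : ∀ x, c x = true → c (bxor x v) = false := by
    intro x hx
    by_contra h
    rw [Bool.not_eq_false] at h
    have h1 := hE x hx
    have h2 := hE (bxor x v) h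
    change ℓ x = b at h1
    change ℓ (bxor x v) = b at h2
    rw [hℓv, h1] at h2
    revert h2; cases b <;> simp
  -- the derivative `Q`
  set Q : (Fin m → Bool) → Bool := fun x => c x ^^ c (bxor x v) with hQdef
  have hQ : IsDegLeFun 2 Q := stub_derivDegree m 2 c v hc
  have hQper : ∀ x, Q (bxor x v) = Q x := by
    intro x; simp only [Q]; rw [iw_bxor_assoc, BuzetChailloux.bxor_self, bxor_zeroVec, Bool.xor_comm]
  have hQcard : #(univ.filter fun x => Q x = true) = 2 * #S := by
    have e : (univ.filter fun x => Q x = true) = S ∪ univ.filter (fun x => c (bxor x v) = true) := by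
      ext x
      simp only [Q, hSdef, mem_union, mem_filter, mem_univ, true_and]
      constructor
      · cases hx : c x <;> cases hx' : c (bxor x v) <;> simp
      · rintro (hx | hx)
        · rw [hx, hcv x hx]; rfl
        · have : c x = false := by
            have := hcv _ hx; rwa [iw_bxor_assoc, BuzetChailloux.bxor_self, bxor_zeroVec] at this
          rw [this, hx]; rfl
    have hdisj : Disjoint S (univ.filter fun x => c (bxor x v) = true) := by
      rw [hSdef, disjoint_filter]; intro x _ hx hx'; rw [hcv x hx] at hx'; exact Bool.false_ne_true hx'
    rw [e, card_union_of_disjoint hdisj]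
    have : #(univ.filter fun x => c (bxor x v) = true) = #S := by
      refine card_nbij' (fun x => bxor x v) (fun x => bxor x v) (fun x hx => ?_) (fun x hx => ?_)
        (fun x _ => by simp [iw_bxor_assoc]) (fun x _ => by simp [iw_bxor_assoc])
      · rw [mem_coe, mem_filter] at hx; exact mem_filter.2 ⟨mem_univ _, hx.2⟩
      · rw [mem_coe, mem_filter] at hx ⊢
        refine ⟨mem_univ _, ?_⟩
        rw [iw_bxor_assoc, BuzetChailloux.bxor_self, bxor_zeroVec]; exact hx.2
    rw [this]; ring
  -- Walsh value at `0`
  have hM : #(univ : Finset (Fin m → Bool)) = 2 ^ m := by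
    rw [card_univ, Fintype.card_fun, Fintype.card_bool, Fintype.card_fin]
  have hW0 : W (fun x => signOf (Q x)) zeroVec = (2 : ℝ) ^ m - 4 * #S := by
    unfold W
    simp_rw [twist_zeroVec_right, mul_one]
    have e : ∀ x, signOf (Q x) = 1 - 2 * (if Q x = true then (1 : ℝ) else 0) := fun x => by
      unfold signOf; cases Q x <;> norm_num
    rw [sum_congr rfl fun x _ => e x, sum_sub_distrib, sum_const, ← mul_sum, sum_boole, hM, hQcard]
    push_cast; ring
  obtain ⟨s, hs⟩ := stub_quadWalshPlateau m Q hQ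
  have h4R : 4 * (#S : ℝ) < (2 : ℝ) ^ m := by exact_mod_cast h4
  have hW0pos : 0 < W (fun x => signOf (Q x)) zeroVec := by rw [hW0]; linarith
  have hWs : W (fun x => signOf (Q x)) zeroVec = (2 : ℝ) ^ s := by
    rcases hs zeroVec with h | h
    · linarith
    · have h4 : (4 : ℝ) ^ s = ((2 : ℝ) ^ s) ^ 2 := by
        rw [show (4 : ℝ) = 2 ^ 2 by norm_num, ← pow_mul, mul_comm, pow_mul]
      rw [h4] at h
      exact (pow_left_inj₀ hW0pos.le (by positivity) (by norm_num : (2 : ℕ) ≠ 0)).1 h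
  have hmain : 4 * #S + 2 ^ s = 2 ^ m := by
    have e : ((4 * #S + 2 ^ s : ℕ) : ℝ) = ((2 ^ m : ℕ) : ℝ) := by push_cast; linarith [hW0, hWs]
    exact_mod_cast e
  refine ⟨s, hmain, ?_⟩
  -- the spectrum vanishes on the half `{⟨v,y⟩ = 1}`
  have hvanish : ∀ y, twist v y = -1 → W (fun x => signOf (Q x)) y = 0 := by
    intro y hy
    have e : W (fun x => signOf (Q x)) y = twist v y * W (fun x => signOf (Q x)) y := by
      unfold W
      rw [mul_sum]
      rw [← Equiv.sum_comp (Equiv.mk (fun x => bxor x v) (fun x => bxor x v) (fun x => by simp [iw_bxor_assoc])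
        (fun x => by simp [iw_bxor_assoc])) (fun x => signOf (Q x) * twist x y)]
      refine sum_congr rfl fun x _ => ?_
      simp only [Equiv.coe_fn_mk]
      rw [hQper, twist_bxor_left]; ring
    rw [hy] at e; linarith
  -- Parseval on the other half
  have hpars : ∑ y, W (fun x => signOf (Q x)) y ^ 2 = (2 : ℝ) ^ m * 2 ^ m := by
    have h := fp_parseval_pm (fun x => signOf (Q x)) univ (fun x _ => by unfold signOf; cases Q x <;> simp) (fun x hx => absurd (mem_univ x) hx)
    rw [h, hM]; push_cast; ring
  set P := univ.filter (fun y : Fin m → Bool => twist v y = 1) with hPdef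
  have hPc : 2 * (#P : ℝ) = 2 ^ m := by
    have hv0 : v ≠ zeroVec := by intro h; rw [h, twist_comm, twist_zeroVec_right] at hv; norm_num at hv
    have hsum : ∑ y : Fin m → Bool, twist v y = 0 := by
      simp_rw [twist_comm v]; rw [sum_twist_left, if_neg hv0]
    have e : ∀ y : Fin m → Bool, twist v y = 2 * (if twist v y = 1 then (1 : ℝ) else 0) - 1 := by
      intro y; rcases twist_eq_one_or v y with h | h <;> rw [h] <;> norm_num
    rw [sum_congr rfl fun y _ => e y, sum_sub_distrib, ← mul_sum, sum_boole, sum_const, hM, nsmul_eq_mul, mul_one] at hsum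
    push_cast at hsum; rw [hPdef]; linarith
  have hle : ∑ y, W (fun x => signOf (Q x)) y ^ 2 ≤ #P * (4 : ℝ) ^ s := by
    rw [← sum_filter_add_sum_filter_not univ (fun y => twist v y = 1)]
    rw [sum_eq_zero (s := univ.filter fun y => ¬ twist v y = 1) fun y hy => ?_, add_zero]
    · rw [← hPdef]
      calc ∑ y ∈ P, W (fun x => signOf (Q x)) y ^ 2 ≤ ∑ _y ∈ P, (4 : ℝ) ^ s :=
            sum_le_sum fun y _ => by
              rcases hs y with h | h
              · rw [h, zero_pow two_ne_zero]; positivity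
              · rw [h]
        _ = #P * (4 : ℝ) ^ s := by rw [sum_const, nsmul_eq_mul]
    · have hy' : twist v y = -1 := (twist_eq_one_or v y).resolve_left (mem_filter.1 hy).2
      rw [hvanish y hy']; ring
  rw [hpars] at hle
  have h2 : 2 * ((2 : ℝ) ^ m * 2 ^ m) ≤ 2 ^ m * 4 ^ s := by nlinarith [hle, hPc]
  have h3 : (2 : ℝ) ^ (2 * m + 1) ≤ 2 ^ (m + 2 * s) := by
    rw [show (2 : ℝ) ^ (2 * m + 1) = 2 * (2 ^ m * 2 ^ m) by ring, show (2 : ℝ) ^ (m + 2 * s) = 2 ^ m * 4 ^ s by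
      rw [pow_add, pow_mul]; norm_num]
    exact h2
  have h4 := (pow_le_pow_iff_right₀ (by norm_num : (1 : ℝ) < 2)).1 h3
  omega

end Summit.QuantumAdvantage.QuantumAdvantage.Theorems.CubicForrelation.NearExactIsExact

end
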